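import Mathlib
import Summits.ValiantsHypothesis.ValiantsHypothesis.Theses.FifoMatching
import Summits.ValiantsHypothesis.ValiantsHypothesis.Theorems.FifoMatchingNNLowDegreeCofactorHardCofactorBuysVertices
import Summits.ValiantsHypothesis.ValiantsHypothesis.Theorems.FifoMatchingNNLowDegreeCofactorHardStubCarveInterval
import Summits.ValiantsHypothesis.ValiantsHypothesis.Theorems.FifoMatchingNNLowDegreeCofactorHardStubSupportGenericQPHard
import Literature.Computability.AlgebraicComplexity.NestFreeMatchingPoly
import HarnessLib

/-!
# Route FifoMatching — crux `NNLowDegreeCofactorHard` (stmt-ValiantsHypothesis-22993): PROOF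

`NNLowDegreeCofactorHard` (crux r5 of route `FifoMatching`, filed by the tenure sweep after
`NNMonotoneHard` was proved): for all `d, c` and all large `n`, every nonzero cofactor `h ∈ ℝ≥0[x]` of
total degree `≤ d` leaves the nest-free (FIFO) matching polynomial `NN_n` quasi-polynomially hard in
the monotone model WITH division, `2^((log₂ n + c)^c) < L₊(NN_n · h) + L₊(h)` — the first rung strictly
between `NNMonotoneHard` (`h = 1`, PROVED) and the load-bearing `NNDivisionHard` (all `h`, OPEN).

This file is the CLOSING COMPOSITION of the registered line
`Cruxes/NNLowDegreeCofactorHard/Lines/freed_vertices.lean` (tenure g6), verbatim its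
`NNLowDegreeCofactorHard_of_line`, over the three landed stubs BY NAME:

* S1 `stub_cofactorBuysVertices` (p584185, val-lit-p6 g11): a cofactor of degree `δ` buys at most `2δ`
  FREED VERTICES (vertex potentials, initial forms are free);
* S2 `FreedVertices.stub_carveInterval` (p585155, val-width-22993-p2; helper p584631): carve an
  even-aligned interval missing the freed vertices — a polynomial with exactly the support of
  `NN_{n'}`, `n ≤ (2d+1)(n'+2)`, of no larger monotone complexity;
* S3 `stub_supportGenericQPHard` (p584731, val-width-22993-p3; helper p584195): the thick-queue bound
  `2^{n'^{1/6}} ≤ L₊(g)` for every `g` with the support of `NN_{n'}` (support-generic re-run of the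
  PROVED `NNMonotoneExpBound`, stmt-22994) beats every quasi-polynomial in `n`.

Credit line of record (val-lit merged desk RULING #54): S1 val-lit-p6 g11 · S2 val-width-22993-p2 ·
S3 val-width-22993-p3 · composition tenure g6 · closing file val-lit-p6 g11.

Honest framing: a MONOTONE rung (over `ℝ≥0`, `L₊` = `complexity` over the semiring) on the
conditional route `FifoMatching`; monotone ≠ general (`Literature.Barriers.ValiantsHypothesis.MonotoneGap`),
`NNDivisionHard` and `NNNotVP` stay OPEN, and NOTHING here is progress on `VP ≠ VNP` (NOT proved).
No definitions, no named facts.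
-/

noncomputable section

-- Sub = Summit single-conjunct layout: the duplicated namespace component is mandated by the tree.
set_option linter.dupNamespace false

namespace Summit.ValiantsHypothesis.ValiantsHypothesis.Theorems.FifoMatching.NNLowDegreeCofactorHard

open MvPolynomial Literature.Computability.AlgebraicComplexity
open scoped NNReal

/-- **`NNLowDegreeCofactorHard` (crux stmt-ValiantsHypothesis-22993 of route `FifoMatching`), PROVED**
by the line `freed_vertices`: given `d, c`, take `n₀` from S3 at `r = 2d`; for `n ≥ n₀` and a nonzero
cofactor `h` of degree `≤ d`, S1 gives `R` (`|R| ≤ 2d`) and `q`, S2 gives `n'` with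
`n ≤ (|R|+1)(n'+2) ≤ (2d+1)(n'+2)` and `g`, and
`2^((log₂ n + c)^c) < L₊(g) ≤ L₊(q) ≤ L₊(NN_n · h) ≤ L₊(NN_n · h) + L₊(h)` (the route's inlined `NN_n`
is definitionally `nestFreeMatchingPoly n ℝ≥0`). [folklore] -/
theorem NNLowDegreeCofactorHard_proof :
    Summit.ValiantsHypothesis.ValiantsHypothesis.Theses.FifoMatching.NNLowDegreeCofactorHard := by
  intro d c
  obtain ⟨n₀, hn₀⟩ := stub_supportGenericQPHard (2 * d) c
  refine ⟨n₀, fun n hn h hh hd => ?_⟩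
  obtain ⟨R, hR, q, hq, hqc⟩ := stub_cofactorBuysVertices n h hh
  obtain ⟨n', hn', g, hg, hgc⟩ := FreedVertices.stub_carveInterval n R q hq
  have hRd : R.card + 1 ≤ 2 * d + 1 := by omega
  have hle : n ≤ (2 * d + 1) * (n' + 2) := hn'.trans (Nat.mul_le_mul_right _ hRd)
  have hlt := hn₀ n hn n' hle g hg
  show 2 ^ ((Nat.log 2 n + c) ^ c) <
    complexity (nestFreeMatchingPoly n ℝ≥0 * h) + complexity h
  calc 2 ^ ((Nat.log 2 n + c) ^ c) < complexity g := hlt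
    _ ≤ complexity q := hgc
    _ ≤ complexity (nestFreeMatchingPoly n ℝ≥0 * h) := hqc
    _ ≤ complexity (nestFreeMatchingPoly n ℝ≥0 * h) + complexity h := Nat.le_add_right _ _

end Summit.ValiantsHypothesis.ValiantsHypothesis.Theorems.FifoMatching.NNLowDegreeCofactorHard

end
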